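import Summits.ValiantsHypothesis.ValiantsHypothesis.Theorems.KPlusLogSqLawTropicalBIntervalOpt

/-!
# Route «KPlusLogSqLaw», crux `TropicalB` (stmt-ValiantsHypothesis-19771) — the BLOCK ORDER LAW:
# on every column window the dominant set passes through its configurations in ERAS, never returning

HONEST FRAMING.  Helper file of the object-search cell `pub-symmetroid` (seat val-sym-trop-p2 g3) for the crux
`Summit.ValiantsHypothesis.ValiantsHypothesis.Theses.KPlusLogSqLaw.TropicalB` (ledger item `stmt-ValiantsHypothesis-19771`, route
`KPlusLogSqLaw`; registered stubs `stub_tropThin` / `stub_tropFat` of `Cruxes/TropicalB/Lines/birth.lean`, each ⟺ the crux), landed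
`--supports`; it does NOT close the item and asserts nothing about `TropicalB` in its window, `WeakLifting`, `KPlusLogSqLaw`,
`MatrixDescartes` (stmt-ValiantsHypothesis-18050) or `VP ≠ VNP`.  STRUCTURAL facts about unique optima (`IsDominant`) of an ARBITRARY
dominance design `(d, v, ε)` of an arbitrary format: no support class, no exponent regime, no sign condition, no chain hypothesis.

THE LAW.  Fix a set `U` of columns.  A CONFIGURATION on `U` is the (row, class) data of a term on the columns of `U`
(`IntervalOpt.restr U`); a dominant term CARRIES it if its restriction to `U` is that configuration.
* `BlockOrder.block_order` — let `a` be dominant at `θa` and `b` at `θb > θa`, let `U` be invariant under the quotient `σ_a⁻¹σ_b`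
  (`a` and `b` map `U` onto the same rows) with `a ≠ b` somewhere on `U`.  Then EVERY dominant carrier of `a`'s `U`-configuration lies
  at a smaller slope than EVERY dominant carrier of `b`'s `U`-configuration — whatever these carriers do off `U`.  Proof: two uses of
  cyclewise monotonicity (`sum_d_lt_of_isDominant_invariant`, conjb-2 g4 / val-sym-trop-p4, `…TropicalCycleMonotone`; used here in
  val-sym-trop-p5's restricted-optimum form `IntervalOpt.sl_lt_of_inOpt`): the pair `(a, b)` forces the `U`-slope of `b`'s configuration
  above that of `a`'s, a reversed pair of carriers would force the opposite.
* `BlockOrder.eras` — the symmetric reading: two distinct configurations on `U` with the same row image that are both carried by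
  dominant terms are carried in DISJOINT, ORDERED slope ranges («eras»).  So through every window `(U, row image)` the dominant set, read
  in slope order, runs through a sequence of configurations WITHOUT EVER RETURNING to an earlier one; material re-enters a column window
  only after the window's row image has changed in between (the counting-tight `(4,4)` witness behind `census_four_four_tight_bound`
  re-uses single incidences up to 9 times — always through a changed row image, never inside an era; check in
  HOME/val-sym-trop-p2/g3/t44.py).  Window = one column with a fixed row: class monotonicity at an entry (lift-p3's
  `d_lt_of_isDominant_of_sameEntry`); window = all columns: trivial; the content is in between.
* `BlockOrder.crossing_switch_excl` — no two CROSSING partial switches: for invariant blocks `S`, `S'` of a dominant pair `(a, b)` on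
  each of which `a ≠ b`, the dominant set never contains both a carrier of (`b` on `S`, `a` on `S'`) and a carrier of (`a` on `S`,
  `b` on `S'`).  This is the support-free form of «autonomous registers meet additively» (R9 of HOME/val-sym-trop-p2/g2/REGISTERS-g2.md;
  kernel instances for product supports: block cuts, torus, `IntervalOpt.card_optRestr_union_le`) and of the NESTING of dominant splices
  in the recombination cube of a dominant pair (its dominant members switch a growing chain of cycle blocks, so at most `#cycles + 1` of
  the `2^{#cycles}` splices are dominant).
* `BlockOrder.step_block_extinct` / `BlockOrder.step_block_unborn` — chain form: for a step `k → k+1` of a dominant chain and an invariant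
  block `U` of the step on which the two terms differ, NO later chain term carries the old `U`-configuration and NO earlier chain term
  carries the new one (val-sym-trop-p5's `exchange_fresh`, `…TropicalBFreshExchanges`, is the statement for the PAIR (old, new); here
  each side separately).

RELATION TO THE TREE.  The mechanism is the tree's (cyclewise monotonicity / restricted optima); the sub-additivity engine
`IntervalOpt.card_optRestr_union_le` → `chain_split` → `designRowD_of_visitedStates` (val-sym-trop-p5 / trop-p1) uses the same
monotonicity of restricted slopes inside a fixed row image.  What is new is the four-term ORDER statement and its «eras» reading, the
located form of the constraint a super-quasi-polynomial family has to live with: windows never cycle, so all recurrence of material goes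
through changes of the row images at the cuts — the VISITED-STATE count that `…TropicalBVisitedStates` isolates as the missing bound.
[folklore: exchange arguments for parametric assignment; the packaging is the cell's]
-/

-- `Summit.ValiantsHypothesis.ValiantsHypothesis.…` repeats a component by the D-0017 layout
-- (single-conjunct summit), which the `dupNamespace` linter flags; the name is mandated.
set_option linter.dupNamespace false
set_option autoImplicit false

namespace Summit.ValiantsHypothesis.ValiantsHypothesis.Theorems.KPlusLogSqLaw

open Summit.ValiantsHypothesis.ValiantsHypothesis.Theorems.MatrixDescartes.Negative
open scoped BigOperators
open Finset

namespace BlockOrder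

variable {m K : ℕ} {d : Fin K → ℕ} {v ε : Fin m → Fin m → Fin K → ℤ}

/-! ## 1. Invariant blocks and row images -/

/-- an invariant column set of the quotient `σ₁⁻¹σ₂` is mapped onto the same rows by `σ₁` and `σ₂`. [folklore] -/
theorem image_eq_of_invariant (σ₁ σ₂ : Equiv.Perm (Fin m)) (T : Finset (Fin m))
    (hT : ∀ b, (σ₁⁻¹ * σ₂) b ∈ T ↔ b ∈ T) : T.image σ₁ = T.image σ₂ := by
  classical
  ext r
  simp only [Finset.mem_image]
  constructor
  · rintro ⟨j, hj, rfl⟩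
    refine ⟨(σ₂⁻¹ * σ₁) j, ?_, by simp [Equiv.Perm.mul_apply]⟩
    exact (hT ((σ₂⁻¹ * σ₁) j)).1 (by simpa [Equiv.Perm.mul_apply] using hj)
  · rintro ⟨j, hj, rfl⟩
    exact ⟨(σ₁⁻¹ * σ₂) j, (hT j).2 hj, by simp [Equiv.Perm.mul_apply]⟩

/-- conversely, equal row images make the column set invariant (cf. `invariant_of_image_eq` of `…TropicalBFreshExchanges`; re-proved
to keep the imports of this file light). [folklore] -/
theorem invariant_of_image_eq' (σ₁ σ₂ : Equiv.Perm (Fin m)) (T : Finset (Fin m))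
    (h : T.image σ₁ = T.image σ₂) : ∀ b, (σ₁⁻¹ * σ₂) b ∈ T ↔ b ∈ T := by
  classical
  intro b
  have key : ∀ c, c ∈ T ↔ σ₁ c ∈ T.image σ₂ := by
    intro c
    rw [← h, Finset.mem_image]
    constructor
    · exact fun hc => ⟨c, hc, rfl⟩
    · rintro ⟨c', hc', e⟩
      rwa [← σ₁.injective e]
  rw [key, Equiv.Perm.mul_apply]
  simp only [Equiv.apply_symm_apply, Equiv.Perm.inv_def, Finset.mem_image]
  constructor
  · rintro ⟨c, hc, e⟩
    rwa [← σ₂.injective e]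
  · exact fun hb => ⟨b, hb, rfl⟩

/-- **restricted slope monotonicity between carriers** (val-sym-trop-p5's `IntervalOpt.sl_lt_of_inOpt` for dominant terms): if `x` is
dominant at `θx`, `y` at `θy > θx`, and they map `U` onto the same rows but differ on `U`, then `sl_U x < sl_U y`. [folklore] -/
theorem sl_lt_of_carriers {θx θy : ℤ} {x y : Equiv.Perm (Fin m) × (Fin m → Fin K)} (hx : IsDominant d v ε θx x)
    (hy : IsDominant d v ε θy y) (hxy : θx < θy) (U : Finset (Fin m)) (himg : U.image x.1 = U.image y.1)
    (hne : IntervalOpt.restr U x ≠ IntervalOpt.restr U y) : IntervalOpt.sl d U x < IntervalOpt.sl d U y :=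
  IntervalOpt.sl_lt_of_inOpt (IntervalOpt.inOpt_mono (Finset.subset_univ U) (IntervalOpt.inOpt_univ_of_isDominant hx))
    (IntervalOpt.inOpt_mono (Finset.subset_univ U) (IntervalOpt.inOpt_univ_of_isDominant hy)) himg hxy hne

/-- two distinct terms are never dominant at the same slope. [folklore] -/
theorem eq_of_isDominant_same {θ : ℤ} {x y : Equiv.Perm (Fin m) × (Fin m → Fin K)} (hx : IsDominant d v ε θ x)
    (hy : IsDominant d v ε θ y) : x = y := by
  by_contra h
  have h1 := hx.2 y (Ne.symm h) hy.1
  have h2 := hy.2 x h hx.1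
  exact lt_asymm h1 h2

/-! ## 2. The block order law -/

/-- **BLOCK ORDER LAW.**  `a` dominant at `θa`, `b` at `θb > θa`, `U` invariant under `σ_a⁻¹σ_b` with `a ≠ b` somewhere on `U`.
If the dominant term `x` carries `b`'s configuration on `U` and the dominant term `y` carries `a`'s configuration on `U`, then
`θy < θx`: every carrier of the earlier configuration precedes every carrier of the later one. [folklore] -/
theorem block_order {θa θb θx θy : ℤ} {a b x y : Equiv.Perm (Fin m) × (Fin m → Fin K)}
    (ha : IsDominant d v ε θa a) (hb : IsDominant d v ε θb b) (hab : θa < θb) (U : Finset (Fin m))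
    (hU : ∀ j, (a.1⁻¹ * b.1) j ∈ U ↔ j ∈ U) (hne : IntervalOpt.restr U a ≠ IntervalOpt.restr U b)
    (hx : IsDominant d v ε θx x) (hxU : IntervalOpt.restr U x = IntervalOpt.restr U b)
    (hy : IsDominant d v ε θy y) (hyU : IntervalOpt.restr U y = IntervalOpt.restr U a) : θy < θx := by
  classical
  have himgab : U.image a.1 = U.image b.1 := image_eq_of_invariant a.1 b.1 U hU
  -- the pair `(a, b)`: the `U`-slope rises from `a` to `b`
  have h1 : IntervalOpt.sl d U a < IntervalOpt.sl d U b := sl_lt_of_carriers ha hb hab U himgab hne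
  -- the carriers: `x` carries `b`'s data, `y` carries `a`'s data on `U`
  have himgxy : U.image x.1 = U.image y.1 := by
    have ex : U.image x.1 = U.image b.1 :=
      Finset.image_congr fun i hi => (IntervalOpt.restr_eq_iff.1 hxU i (Finset.mem_coe.1 hi)).1
    have ey : U.image y.1 = U.image a.1 :=
      Finset.image_congr fun i hi => (IntervalOpt.restr_eq_iff.1 hyU i (Finset.mem_coe.1 hi)).1
    rw [ex, ey, himgab]
  have hnexy : IntervalOpt.restr U x ≠ IntervalOpt.restr U y := by
    rw [hxU, hyU]; exact Ne.symm hne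
  rcases lt_trichotomy θx θy with h | h | h
  · -- reversed carriers would force the `U`-slope of `b`'s data below that of `a`'s
    have h2 := sl_lt_of_carriers hx hy h U himgxy hnexy
    rw [IntervalOpt.sl_congr (d := d) hxU, IntervalOpt.sl_congr (d := d) hyU] at h2
    exact absurd h1 (lt_asymm h2)
  · subst h
    exact absurd (congrArg (IntervalOpt.restr U) (eq_of_isDominant_same hx hy)) hnexy
  · exact h

/-- **ERAS.**  Two distinct configurations on a window `U` with the same row image, both carried by dominant terms (`x` at `θx`, `y` at
`θy > θx`), are carried in disjoint ordered slope ranges: every dominant carrier `z` of `x`'s configuration satisfies `θz < θy`, and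
every dominant carrier `w` of `y`'s configuration satisfies `θx < θw`.  The dominant set never returns to a configuration it has left
while the window's row image is unchanged. [folklore] -/
theorem eras {θx θy : ℤ} {x y : Equiv.Perm (Fin m) × (Fin m → Fin K)} (hx : IsDominant d v ε θx x)
    (hy : IsDominant d v ε θy y) (hxy : θx < θy) (U : Finset (Fin m)) (himg : U.image x.1 = U.image y.1)
    (hne : IntervalOpt.restr U x ≠ IntervalOpt.restr U y) :
    (∀ {θz : ℤ} {z : Equiv.Perm (Fin m) × (Fin m → Fin K)}, IsDominant d v ε θz z →
        IntervalOpt.restr U z = IntervalOpt.restr U x → θz < θy) ∧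
      (∀ {θw : ℤ} {w : Equiv.Perm (Fin m) × (Fin m → Fin K)}, IsDominant d v ε θw w →
        IntervalOpt.restr U w = IntervalOpt.restr U y → θx < θw) := by
  have hU := invariant_of_image_eq' x.1 y.1 U himg
  exact ⟨fun hz hzU => block_order hx hy hxy U hU hne hy rfl hz hzU,
    fun hw hwU => block_order hx hy hxy U hU hne hw hwU hx rfl⟩

/-- **No crossing switches** (support-free autonomy).  For invariant blocks `S`, `S'` of a dominant pair `(a, b)` on each of which
`a ≠ b`, the dominant set never contains both a carrier `x` of (`b` on `S`, `a` on `S'`) and a carrier `y` of (`a` on `S`, `b` on `S'`).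
[folklore] -/
theorem crossing_switch_excl {θa θb θx θy : ℤ} {a b x y : Equiv.Perm (Fin m) × (Fin m → Fin K)}
    (ha : IsDominant d v ε θa a) (hb : IsDominant d v ε θb b) (hab : θa < θb) (S S' : Finset (Fin m))
    (hS : ∀ j, (a.1⁻¹ * b.1) j ∈ S ↔ j ∈ S) (hS' : ∀ j, (a.1⁻¹ * b.1) j ∈ S' ↔ j ∈ S')
    (hneS : IntervalOpt.restr S a ≠ IntervalOpt.restr S b) (hneS' : IntervalOpt.restr S' a ≠ IntervalOpt.restr S' b)
    (hx : IsDominant d v ε θx x) (hxS : IntervalOpt.restr S x = IntervalOpt.restr S b)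
    (hxS' : IntervalOpt.restr S' x = IntervalOpt.restr S' a)
    (hy : IsDominant d v ε θy y) (hyS : IntervalOpt.restr S y = IntervalOpt.restr S a)
    (hyS' : IntervalOpt.restr S' y = IntervalOpt.restr S' b) : False := by
  have h1 : θy < θx := block_order ha hb hab S hS hneS hx hxS hy hyS
  have h2 : θx < θy := block_order ha hb hab S' hS' hneS' hy hyS' hx hxS'
  exact lt_asymm h1 h2

/-! ## 3. Chain form: the two sides of a step are extinct after it and unborn before it -/

section Chain

variable (d v ε) {n : ℕ} (θ : ℕ → ℤ) (p : ℕ → Equiv.Perm (Fin m) × (Fin m → Fin K))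

/-- slopes of a dominant chain (integer slopes increasing step by step) increase between any two indices. [folklore] -/
theorem chain_theta_lt (hθ : ∀ k < n, θ k < θ (k + 1)) {j k : ℕ} (hjk : j < k) (hk : k ≤ n) : θ j < θ k := by
  induction k with
  | zero => exact absurd hjk (Nat.not_lt_zero _)
  | succ k ih =>
    have hstep := hθ k hk
    rcases Nat.lt_succ_iff_lt_or_eq.mp hjk with h | h
    · exact (ih h (Nat.le_of_succ_le hk)).trans hstep
    · subst h; exact hstep

/-- **the old configuration of a step is extinct after it**: for a step `k → k+1` of a dominant chain and a block `U` invariant under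
the step's quotient on which the two terms differ, no later chain term carries `p k`'s configuration on `U`. [folklore] -/
theorem step_block_extinct (hdom : ∀ k ≤ n, IsDominant d v ε (θ k) (p k)) (hθ : ∀ k < n, θ k < θ (k + 1))
    {k : ℕ} (hk : k < n) (U : Finset (Fin m)) (hU : ∀ j, ((p k).1⁻¹ * (p (k + 1)).1) j ∈ U ↔ j ∈ U)
    (hne : IntervalOpt.restr U (p k) ≠ IntervalOpt.restr U (p (k + 1))) {j : ℕ} (hj : k + 1 < j) (hjn : j ≤ n) :
    IntervalOpt.restr U (p j) ≠ IntervalOpt.restr U (p k) := by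
  intro hcarry
  have := block_order (hdom k hk.le) (hdom (k + 1) hk) (hθ k hk) U hU hne (hdom (k + 1) hk) rfl (hdom j hjn) hcarry
  exact absurd (chain_theta_lt θ hθ hj hjn) (lt_asymm this)

/-- **the new configuration of a step is unborn before it**: symmetrically, no earlier chain term carries `p (k+1)`'s configuration
on `U`. [folklore] -/
theorem step_block_unborn (hdom : ∀ k ≤ n, IsDominant d v ε (θ k) (p k)) (hθ : ∀ k < n, θ k < θ (k + 1))
    {k : ℕ} (hk : k < n) (U : Finset (Fin m)) (hU : ∀ j, ((p k).1⁻¹ * (p (k + 1)).1) j ∈ U ↔ j ∈ U)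
    (hne : IntervalOpt.restr U (p k) ≠ IntervalOpt.restr U (p (k + 1))) {i : ℕ} (hi : i < k) :
    IntervalOpt.restr U (p i) ≠ IntervalOpt.restr U (p (k + 1)) := by
  intro hcarry
  have := block_order (hdom k hk.le) (hdom (k + 1) hk) (hθ k hk) U hU hne (hdom i (by omega)) hcarry (hdom k hk.le) rfl
  exact absurd (chain_theta_lt θ hθ hi hk.le) (lt_asymm this)

end Chain

end BlockOrder

/-! ## 4. Eras are convex (appended 2026-08-26, same seat): between two carriers of a configuration, every dominant term with the
same row image on the window carries it too -/

namespace BlockOrder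

variable {m K : ℕ} {d : Fin K → ℕ} {v ε : Fin m → Fin m → Fin K → ℤ}

/-- **ERAS ARE INTERVALS.**  If the dominant terms `x` (at `θx`) and `z` (at `θz`) carry the same configuration on the window `U`, then
every dominant term `y` at a slope strictly between `θx` and `θz` that maps `U` onto the same rows carries that configuration as well:
through a window with a fixed row image the dominant set never leaves a configuration and comes back. [folklore] -/
theorem era_convex {θx θy θz : ℤ} {x y z : Equiv.Perm (Fin m) × (Fin m → Fin K)} (hx : IsDominant d v ε θx x)
    (hy : IsDominant d v ε θy y) (hz : IsDominant d v ε θz z) (hxy : θx < θy) (hyz : θy < θz) (U : Finset (Fin m))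
    (himg : U.image x.1 = U.image y.1) (hxz : IntervalOpt.restr U x = IntervalOpt.restr U z) :
    IntervalOpt.restr U y = IntervalOpt.restr U x := by
  by_contra hne
  -- `x` before `y` with different configurations on the same row image: every carrier of `x`'s configuration precedes `y` …
  have h := (eras hx hy hxy U himg (Ne.symm hne)).1 hz hxz.symm
  -- … but `z` carries it after `y`
  exact lt_asymm hyz h

/-- chain form of `era_convex`: along a dominant chain, if `p i` and `p k` (`i < k`) agree on the window `U` and `p j` (`i < j < k`)
maps `U` onto the same rows as `p i`, then `p j` agrees with them on `U`. [folklore] -/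
theorem chain_era_convex {n : ℕ} (θ : ℕ → ℤ) (p : ℕ → Equiv.Perm (Fin m) × (Fin m → Fin K))
    (hdom : ∀ k ≤ n, IsDominant d v ε (θ k) (p k)) (hθ : ∀ k < n, θ k < θ (k + 1)) {i j k : ℕ} (hij : i < j) (hjk : j < k)
    (hk : k ≤ n) (U : Finset (Fin m)) (himg : U.image (p i).1 = U.image (p j).1)
    (hik : IntervalOpt.restr U (p i) = IntervalOpt.restr U (p k)) : IntervalOpt.restr U (p j) = IntervalOpt.restr U (p i) :=
  era_convex (hdom i (by omega)) (hdom j (by omega)) (hdom k hk) (chain_theta_lt θ hθ hij (by omega))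
    (chain_theta_lt θ hθ hjk hk) U himg hik

end BlockOrder

end Summit.ValiantsHypothesis.ValiantsHypothesis.Theorems.KPlusLogSqLaw
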